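import Literature.IUT.HodgeTheaters.PiAvatarLocalInvolution
import Literature.IUT.HodgeTheaters.PiAvatarGlobalInvolution
import Literature.IUT.HodgeTheaters.PiAvatarOrbitCategorySquares
import HarnessLib

/-!
# The `[−1]`-compatibility square of Example 6.3 (ii) AT A GOOD PLACE OF THE GENUINE INITIAL Θ-DATA: the local
# negative automorphism of `𝒟_v̲` and the global `±`-involution of `𝒟^{⊚±}` commute with `φ^{Θell}_{•,v̲}` (proof-only)

S. Mochizuki, *Inter-universal Teichmüller theory I*, kurims manuscript (May 2020), Example 6.3 (i) p. 161 ("the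
natural composite morphism `X̲→_v → X_v → X_K` … determines a natural morphism `φ^{Θell}_{•,v} : 𝒟_v → 𝒟^{⊚±}`"),
(ii) p. 161 ("one verifies immediately that `φ^{Θell}_±` is equivariant with respect to these poly-actions of
`𝔽_l^{⋊±}`" — the NEGATIVE case `γ = −1`), Def 6.1 (iii) p. 157 (negative automorphisms of `†𝒟_v`), (v) p. 158 (the
double covering `𝒟^{⊚±} → 𝒟^⊚`, `{±1} ⊆ 𝔽_l^{⋊±} ≅ Aut_K(X̲_K)`) ([IUTchI] Ex 6.3 (ii) p.161) [claim: Mochizuki2012,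
status: disputed] (D-0012 claim key, series status DISPUTED — an instance-level consequence over abc-iut-L5-t2's REAL
`InitialThetaData` in the Π-avatar; nothing of the series is asserted, no side is taken on [IUTchIII] Cor. 3.12).

WHY (abc-iut-L5-lead RULINGS #28 (1); abc-iut-L5-t13 p420660 `Ex63.phiEllSync_of_negCompatModel`,
`negCompatModel_iff_commutes`): after tonight's reductions the α-family (Prop 6.5 (i) s.2) AND the β-family (Prop 6.6
(ii)(iii), 6.8 (i), Rmk 6.12.1) of the §6 cone rows wait on ONE label-free condition at the genuine kit — «at each `v̲`
some lift `b ∈ Aut_±(𝒟^{⊚±})` of `(0,−1)` and some `a ∈ Aut(𝒟_v̲)` with `a ≫ φ^{Θell}_{•,v̲} = φ^{Θell}_{•,v̲} ≫ b`», i.e.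
in abc-iut-L5-t4's orbit-category avatar the coset condition «`N_A(Π_{v̲})` meets `n·Π_{X̲_K}`» for `n` the global
involution.  THIS FILE PROVES THAT CONDITION AT EVERY GOOD PLACE (Π-avatar, `Π_v̲ := Π_{X̲→_v̲}` of Def 3.1 (f)),
conditional only on abc-iut-L5-t1's typed §1 claims `ArrowCoveringClaims`: ONE element `c ∈ Π_{C̲→_v̲} \ Π_{X̲→_v̲}`
induces (a) a non-trivial involutive automorphism of `𝒟_v̲ = ℬ(Π_{X̲→_v̲})⁰` (abc-iut-L5-t4 `exists_localInvolution`,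
p421621), (b) THE non-trivial involution of `𝒟^{⊚±} = ℬ(Π_{X̲_K})⁰` over `𝒟^⊚` (p421129/p421269: `c ∈ Π_{C̲_K} \ Π_{X̲_K}`),
and (c) the square along `φ^{Θell}_{•,v̲} = (xΠ_{v̲} ↦ xΠ_{X̲_K})` COMMUTES ON THE NOSE (abc-iut-L5-t13's
`OrbitCat.autOfNormalizer_comp_incl`, p421603).  Bad places (tempered `X̲̲_v`) are NOT covered (G-L5t4g3-2 (iii)).

* `InitialThetaData.PiXarrow_le_PiXund`, `PiCarrow_le_PiCund`, `not_mem_PiXund_of_mem_PiCarrow` (cartesian square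
  `Π_{X̲→} = Π_{X̲} ∩ Π_{C̲→}` of §1, from `hA`);
* **`InitialThetaData.exists_negCompat_good`** — the statement above.

Proof-only; typed ≠ proved elsewhere.
-/

namespace Literature.IUT.HodgeTheaters

open CategoryTheory

universe u v w

section Local

variable {F : Type u} {K : Type v} {Fbar : Type w} [Field F] [NumberField F] [Field K]
  [NumberField K] [Algebra F K] [Field Fbar] [Algebra F Fbar] [Algebra K Fbar]
  {E : WeierstrassCurve F} [E.IsElliptic] {l : ℕ} {P : BadPlacePredicates K}
  (D : InitialThetaData F K Fbar E l P)

namespace InitialThetaData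

/-- `Π_{X̲→_K} ≤ Π_{X̲_K}` (t1's `piXarrow_le_piXbar` along `embK`; Def 3.1 (f) / §1 cartesian diagram).
([IUTchI] Def 3.1 (f) p.63) [claim: Mochizuki2012, status: disputed] -/
theorem PiXarrow_le_PiXund : D.PiXarrow ≤ D.PiXund :=
  Subgroup.map_mono D.geom.pe.piXarrow_le_piXbar

/-- `Π_{C̲→_K} ≤ Π_{C̲_K}` (t1's `piCarrow_le_piCbar` along `embK`). ([IUTchI] Def 3.1 (f) p.63) [claim: Mochizuki2012, status: disputed] -/
theorem PiCarrow_le_PiCund : D.PiCarrow ≤ D.PiCund :=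
  Subgroup.map_mono D.geom.pe.piCarrow_le_piCbar

/-- The cartesian square of §1 (`Π_{X̲→} = Π_{X̲} ∩ Π_{C̲→}`, t1's `ArrowCoveringClaims.cartesian`) along `embK`: an
element of `Π_{C̲→_K}` outside `Π_{X̲→_K}` is outside `Π_{X̲_K}`. ([IUTchI] §1 p.38) [claim: Mochizuki2012, status: disputed] -/
theorem not_mem_PiXund_of_mem_PiCarrow (hA : D.geom.pe.ArrowCoveringClaims) {c : D.PiC}
    (hc : c ∈ D.PiCarrow) (hcX : c ∉ D.PiXarrow) : c ∉ D.PiXund := by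
  intro hcU
  apply hcX
  have h : c ∈ D.PiXund ⊓ D.PiCarrow := ⟨hcU, hc⟩
  rw [InitialThetaData.PiXund, InitialThetaData.PiCarrow,
    ← Subgroup.map_inf_eq _ _ _ D.geom.embK_injective, ← hA.cartesian] at h
  exact h

/-- **Example 6.3 (ii), negative case, at a good place of the genuine initial Θ-data (Π-avatar; conditional on the
printed §1 claims `hA`).** For every subgroup `Gv` of `G_F` (a decomposition group `G_v̲`), write
`Π_v̲ := Π_{X̲→_K} ∩ augGF⁻¹(Gv)` (Def 3.1 (e)(f): `Π_v̲ := Π_{X̲→_v̲}`) and `φ := (xΠ_v̲ ↦ xΠ_{X̲_K}) : ℬ(Π_v̲)⁰ → ℬ(Π_{X̲_K})⁰`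
(`φ^{Θell}_{•,v̲} : 𝒟_v̲ → 𝒟^{⊚±}` of Ex 6.3 (i), in the orbit category of `Π_{C_F}`).  Then ONE element `c` of `Π_{C_F}`
normalises both `Π_v̲` and `Π_{X̲_K}` and induces: a NON-TRIVIAL involutive automorphism `a` of `𝒟_v̲` (a negative
automorphism, Def 6.1 (iii)), the NON-TRIVIAL involution `b` of `𝒟^{⊚±}` (the `−1 ∈ 𝔽_l^{⋊±}`, Def 6.1 (v)), and
`a ≫ φ = φ ≫ b` — the `[−1]`-compatibility of `φ^{Θell}_{•,v̲}`, i.e. the label-free (β)-condition `NegCompat` of the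
§6 cone rows, read at `v̲`. ([IUTchI] Ex 6.3 (ii) p.161) [claim: Mochizuki2012, status: disputed] -/
theorem exists_negCompat_good (hA : D.geom.pe.ArrowCoveringClaims) (Gv : Subgroup (Fbar ≃ₐ[F] Fbar)) :
    ∃ (c : D.PiC)
      (hcv : c ∈ Subgroup.normalizer ((D.PiXarrow ⊓ Gv.comap D.augGF : Subgroup D.PiC) : Set D.PiC))
      (hcK : c ∈ Subgroup.normalizer ((D.PiXund : Subgroup D.PiC) : Set D.PiC)),
      OrbitCat.autOfNormalizer c hcv ≠ Iso.refl (OrbitCat.of (D.PiXarrow ⊓ Gv.comap D.augGF)) ∧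
      OrbitCat.autOfNormalizer c hcv ≪≫ OrbitCat.autOfNormalizer c hcv =
        Iso.refl (OrbitCat.of (D.PiXarrow ⊓ Gv.comap D.augGF)) ∧
      OrbitCat.autOfNormalizer c hcK ≠ Iso.refl (OrbitCat.of D.PiXund) ∧
      OrbitCat.autOfNormalizer c hcK ≪≫ OrbitCat.autOfNormalizer c hcK = Iso.refl (OrbitCat.of D.PiXund) ∧
      (OrbitCat.autOfNormalizer c hcv).hom ≫
          OrbitCat.homOfElem 1 (OrbitCat.one_conj_mem_of_le
            ((inf_le_left.trans D.PiXarrow_le_PiXund :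
              D.PiXarrow ⊓ Gv.comap D.augGF ≤ D.PiXund))) =
        OrbitCat.homOfElem 1 (OrbitCat.one_conj_mem_of_le
            ((inf_le_left.trans D.PiXarrow_le_PiXund :
              D.PiXarrow ⊓ Gv.comap D.augGF ≤ D.PiXund))) ≫
          (OrbitCat.autOfNormalizer c hcK).hom := by
  obtain ⟨-, c, hcv, hcC, hcX, hne, hsq⟩ := D.exists_localInvolution hA Gv
  -- `c ∈ Π_{C̲→_K} ≤ Π_{C̲_K}` normalises `Π_{X̲_K}` (index two), and lies outside `Π_{X̲_K}` (cartesian square)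
  have hcCarrow : c ∈ D.PiCarrow := hcC.1
  have hcK : c ∈ Subgroup.normalizer ((D.PiXund : Subgroup D.PiC) : Set D.PiC) :=
    D.piCund_le_normalizer_piXund (D.PiCarrow_le_PiCund hcCarrow)
  have hcXarrow : c ∉ D.PiXarrow := fun h => hcX ⟨h, hcC.2⟩
  have hcU : c ∉ D.PiXund := D.not_mem_PiXund_of_mem_PiCarrow hA hcCarrow hcXarrow
  refine ⟨c, hcv, hcK, hne, hsq, fun h => hcU ((OrbitCat.autOfNormalizer_eq_refl_iff hcK).1 h), ?_, ?_⟩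
  · -- the global automorphism squares to the identity: `c² ∈ Π_{X̲_K}` by index two in `Π_{C̲_K}`
    rw [OrbitCat.autOfNormalizer_trans, OrbitCat.autOfNormalizer_eq_refl_iff]
    have hcCund : c ∈ D.PiCund := D.PiCarrow_le_PiCund hcCarrow
    have key := (Subgroup.mul_mem_iff_of_index_two D.piXund_relIndex_piCund
      (a := ⟨c, hcCund⟩) (b := ⟨c, hcCund⟩)).2 Iff.rfl
    exact Subgroup.mem_subgroupOf.mp key
  · exact OrbitCat.autOfNormalizer_comp_incl (inf_le_left.trans D.PiXarrow_le_PiXund) hcv hcK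

end InitialThetaData

end Local

end Literature.IUT.HodgeTheaters
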